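import Literature.AnabelianGeometry.EtaleTheta.Thm56SubdagProofs
import Literature.AnabelianGeometry.EtaleTheta.Discharge.Sec5ReachableFromBNForcesDepth
import HarnessLib

/-!
# [EtTh] Thm. 5.6 (i), last step «sufficient to imply the preservation … for arbitrary `S`» (T56-L10) from ANY uniqueness
# principle for the rigidity family — in particular from print's ROOFS `S″ → S`, `S″ → B_N` (proof-only)

S. Mochizuki, *The étale theta function and its Frobenioid-theoretic manifestations*, Publ. RIMS **45** (2009) [MochizukiEtTh2009],
Thm. 5.6 p.328 (PDF p.102), proof p.329 (PDF p.103) l.23–27: «Moreover, by the construction applied in the proof of Proposition 5.5,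
this preservation of the natural isomorphism of Proposition 5.5 in the specific case of `S₂` is sufficient to imply the preservation
of the natural isomorphism of Proposition 5.5 for arbitrary `(l, N)`-theta-saturated `S ∈ Ob(C)`»; the «construction» = the transport
along linear morphisms `S″ → S`, `S″ → S′`, Prop. 5.5 proof p.328 (PDF p.102) l.2–11.

abc-iut cell, layer L2, seat abc-iut-w5-d013 (gen 6); sequel of `Sec5Prop55RoofIndependentOfLaws.lean` (p460420, Prop. 5.5 chain head in
roof form) and of the finding F-w5d013g5-1 / abc-iut-L2-t4's audit INFO-1 on p449776 («hreach enters the chain ONLY via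
`rigidityFamily_unique_of` / `cyclotomicRigidity_of(_sub)` ⇒ one-binder swap at the K4 chain head»).  PROOF-ONLY (no definition, no
new named fact); abc-iut-L2-d4's `Discharge/Sec5Thm56.preservesRigidityIso_of` / `cyclotomicRigidityPreserved_of` and abc-iut-w5-d020's
`Thm56Sub.cyclotomicRigidityPreserved_of_sub` are NOT edited: this file re-runs d4's reduction with the uniqueness input ABSTRACTED.

WHAT IS PROVED (abstract §5 datum `𝔉 : ThetaFrobenioid C D`, self-equivalence `Ψ` with a faithful 1-compatible `Ψ^bs`):
* `preservesRigidityIso_of_unique` / `cyclotomicRigidityPreserved_of_unique` — d4's reduction of the second clause of Thm. 5.6 to its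
  instance `hBN` at `S₂ = B_N`, with the fixed-source `hreach : LinearlyReachableFromBN` (a DEPTH constraint, F-w5d013g5-1) replaced by
  the bare UNIQUENESS PRINCIPLE it was used for — `huniq`: a rigidity family functorial for linear morphisms that agrees with `ρ` at `B_N`
  IS `ρ` («by the construction applied in the proof of Proposition 5.5») — and with d4's unit pull-back naturality `hpull` asked at
  LINEAR `φ` only (the only use; print's [FrdI] Thm. 3.4 (iv) clause; a THEOREM at the genuine data: this seat's
  `hpull_of_isLinear_ofConnectedTemperoidData`, p449195);
* `preservesRigidityIso_of_roofs` / `cyclotomicRigidityPreserved_of_roofs` — `huniq` DISCHARGED by print's ROOFS (this seat's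
  `rigidityFamily_unique_of_roof`, p451685): **Thm. 5.6 (both clauses) modulo d4's cited inputs with `hreach ↦ hroof`**;
* `cyclotomicRigidityPreserved_of_reach` — back-compatibility: d4's own binder list (fixed source `hreach`), `hpull` linear-only;
* `Thm56Sub.cyclotomicRigidityPreserved_of_sub_roofs` — abc-iut-w5-d020's T56-A assembly (`hBN` DERIVED by `transportAtBN_of`, T56-L09) with
  `hreach ↦ hroof` and `hpull` linear-only: the Thm. 5.6 (i) chain head in ROOF form, companion of `cyclotomicRigidity_of_laws_roofs`.
HONEST FRAMING: kernel-checked implications between typed statements about the abstract §5 data; the roofs, `aΨ`/`haΨ`, `hlin`, `hpull`,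
the T56-L09 inputs are HYPOTHESES (binders), not asserted; [EtTh] is refereed pre-IUT material; nothing here bears on [IUTchIII]
Cor. 3.12 — no side is taken; typed ≠ proved.
-/

namespace Literature.AnabelianGeometry.EtaleTheta

open CategoryTheory
open Literature.AlgebraicGeometry.Frobenioids FrobenioidCyclotomicRigidity

universe w v v' u u'

namespace ThetaFrobenioid

variable {C : Type u} [Category.{v} C] {D : Type u'} [Category.{v'} D] {𝔉 : ThetaFrobenioid.{w} C D}
variable (Ψ : C ≌ C)

section Transport

variable (Ψbs : D ⥤ D) [Ψbs.Faithful] (eΨ : Ψ.functor ⋙ 𝔉.base ≅ 𝔉.base ⋙ Ψbs)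
include eΨ

/-- **Thm. 5.6, second clause, REDUCED to its instance `hBN` at `S₂ = B_N` by a UNIQUENESS PRINCIPLE `huniq`** («by the construction
applied in the proof of Proposition 5.5, this preservation … in the specific case of `S₂` is sufficient to imply the preservation …
for arbitrary `(l, N)`-theta-saturated `S`», p.329 (PDF p.103) l.23–27): abc-iut-L2-d4's `preservesRigidityIso_of` with `hreach :
LinearlyReachableFromBN` replaced by what it supplied — a rigidity family functorial for linear morphisms and agreeing with `ρ` at `B_N`
equals `ρ` — and `hpull` asked at linear `φ` only.  Proof = d4's: the transported family `Ψ⁻¹ ∘ ρ_{Ψ S} ∘ aΨ_S` is functorial for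
linear morphisms (`hlin`, `haΨ`, `hpull`) and agrees with `ρ` at `B_N` (`hBN`), hence IS `ρ`.
[cite: MochizukiEtTh2009, Thm 5.6 proof p.329 (PDF p.103)] -/
theorem preservesRigidityIso_of_unique
    (aΨ : ∀ S : C, 𝔉.lDeltaModN S ≃* 𝔉.lDeltaModN (Ψ.functor.obj S))
    (ρ : RigidityFamily 𝔉) (hB : 𝔉.IsThetaSaturated 𝔉.BN)
    (huniq : ∀ ρ' : RigidityFamily 𝔉, IsFunctorialLinear 𝔉 ρ' → ρ' 𝔉.BN hB = ρ 𝔉.BN hB → ρ' = ρ)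
    (hρ : IsFunctorialLinear 𝔉 ρ)
    (hlin : PreFrobenioidData.PreservesMor Ψ.functor 𝔉.IsLinear 𝔉.IsLinear)
    (haΨ : ∀ {S T : C} (φ : S ⟶ T) (x : 𝔉.lDeltaModN S),
      aΨ T (𝔉.lDeltaModNMap φ x) = 𝔉.lDeltaModNMap (Ψ.functor.map φ) (aΨ S x))
    (hpull : ∀ {S T : C} (φ : S ⟶ T), 𝔉.IsLinear φ → ∀ (u : 𝔉.muTorsion T 𝔉.N)
      (hu : Ψ.functor.mapAut T (u : Aut T) ∈ 𝔉.muTorsion (Ψ.functor.obj T) 𝔉.N),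
      Ψ.functor.mapAut S (𝔉.muTorsionPull φ 𝔉.N u : Aut S) =
        (𝔉.muTorsionPull (Ψ.functor.map φ) 𝔉.N ⟨_, hu⟩ : Aut (Ψ.functor.obj S)))
    (hBN : ∀ (hΨB : 𝔉.IsThetaSaturated (Ψ.functor.obj 𝔉.BN)) (x : 𝔉.lDeltaModN 𝔉.BN),
      (Ψ.functor.mapAut 𝔉.BN (ρ 𝔉.BN hB x : Aut 𝔉.BN) : Aut (Ψ.functor.obj 𝔉.BN)) =
        ρ (Ψ.functor.obj 𝔉.BN) hΨB (aΨ 𝔉.BN x)) :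
    PreservesRigidityIso 𝔉 Ψ ρ aΨ := by
  have hsat := preservesThetaSaturated_of Ψ Ψbs eΨ aΨ
  have hcyc := preservesCyclotomes_of Ψ Ψbs eΨ (𝔉 := 𝔉)
  obtain ⟨μE, hμE⟩ := exists_muTorsionEquiv Ψ Ψbs eΨ (𝔉 := 𝔉) 𝔉.N
  refine ⟨hcyc, ?_⟩
  -- the transported family `ρ' S := Ψ⁻¹ ∘ ρ_{Ψ S} ∘ aΨ_S`
  let ρ' : RigidityFamily 𝔉 := fun S hS =>
    ((aΨ S).trans (ρ (Ψ.functor.obj S) ((hsat S).mp hS))).trans (μE S).symm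
  have hρ'ap : ∀ (S : C) (hS : 𝔉.IsThetaSaturated S) (y : 𝔉.lDeltaModN S),
      μE S (ρ' S hS y) = ρ (Ψ.functor.obj S) ((hsat S).mp hS) (aΨ S y) :=
    fun S hS y => (μE S).apply_symm_apply _
  -- `ρ'` is functorial for linear morphisms
  have hρ' : IsFunctorialLinear 𝔉 ρ' := by
    intro S T φ hφ hS hT x
    apply (μE S).injective
    apply Subtype.ext
    have hu : Ψ.functor.mapAut T (ρ' T hT (𝔉.lDeltaModNMap φ x) : Aut T) ∈
        𝔉.muTorsion (Ψ.functor.obj T) 𝔉.N := hcyc T _ (ρ' T hT (𝔉.lDeltaModNMap φ x)).2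
    have hw : (⟨_, hu⟩ : 𝔉.muTorsion (Ψ.functor.obj T) 𝔉.N) =
        ρ (Ψ.functor.obj T) ((hsat T).mp hT) (𝔉.lDeltaModNMap (Ψ.functor.map φ) (aΨ S x)) := by
      rw [← haΨ, ← hρ'ap T hT (𝔉.lDeltaModNMap φ x)]
      exact Subtype.ext (hμE T _).symm
    rw [hμE, hpull φ hφ _ hu, hw, hρ (Ψ.functor.map φ) (hlin φ hφ) ((hsat S).mp hS) ((hsat T).mp hT),
      hρ'ap S hS x]
  -- `ρ'` agrees with `ρ` at `B_N`
  have hBN' : ρ' 𝔉.BN hB = ρ 𝔉.BN hB := by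
    apply MulEquiv.ext
    intro x
    apply (μE 𝔉.BN).injective
    apply Subtype.ext
    rw [hρ'ap 𝔉.BN hB x, hμE]
    exact (hBN _ x).symm
  have heq : ρ' = ρ := huniq ρ' hρ' hBN'
  intro S hS hΨS x
  have hx : ρ S hS x = ρ' S hS x := by rw [heq]
  rw [hx, ← hμE S, hρ'ap S hS x]

/-- **[EtTh] Theorem 5.6 (both clauses, abc-iut-L2-t4's `CyclotomicRigidityPreserved Ψ ρ aΨ`) from a uniqueness principle**:
abc-iut-L2-d4's `cyclotomicRigidityPreserved_of` with `hreach ↦ huniq` and `hpull` linear-only.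
[cite: MochizukiEtTh2009, Thm 5.6 p.328–329 (PDF pp.102–103)] -/
theorem cyclotomicRigidityPreserved_of_unique
    (aΨ : ∀ S : C, 𝔉.lDeltaModN S ≃* 𝔉.lDeltaModN (Ψ.functor.obj S))
    (ρ : RigidityFamily 𝔉) (hB : 𝔉.IsThetaSaturated 𝔉.BN)
    (huniq : ∀ ρ' : RigidityFamily 𝔉, IsFunctorialLinear 𝔉 ρ' → ρ' 𝔉.BN hB = ρ 𝔉.BN hB → ρ' = ρ)
    (hρ : IsFunctorialLinear 𝔉 ρ)
    (hlin : PreFrobenioidData.PreservesMor Ψ.functor 𝔉.IsLinear 𝔉.IsLinear)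
    (haΨ : ∀ {S T : C} (φ : S ⟶ T) (x : 𝔉.lDeltaModN S),
      aΨ T (𝔉.lDeltaModNMap φ x) = 𝔉.lDeltaModNMap (Ψ.functor.map φ) (aΨ S x))
    (hpull : ∀ {S T : C} (φ : S ⟶ T), 𝔉.IsLinear φ → ∀ (u : 𝔉.muTorsion T 𝔉.N)
      (hu : Ψ.functor.mapAut T (u : Aut T) ∈ 𝔉.muTorsion (Ψ.functor.obj T) 𝔉.N),
      Ψ.functor.mapAut S (𝔉.muTorsionPull φ 𝔉.N u : Aut S) =
        (𝔉.muTorsionPull (Ψ.functor.map φ) 𝔉.N ⟨_, hu⟩ : Aut (Ψ.functor.obj S)))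
    (hBN : ∀ (hΨB : 𝔉.IsThetaSaturated (Ψ.functor.obj 𝔉.BN)) (x : 𝔉.lDeltaModN 𝔉.BN),
      (Ψ.functor.mapAut 𝔉.BN (ρ 𝔉.BN hB x : Aut 𝔉.BN) : Aut (Ψ.functor.obj 𝔉.BN)) =
        ρ (Ψ.functor.obj 𝔉.BN) hΨB (aΨ 𝔉.BN x)) :
    CyclotomicRigidityPreserved 𝔉 Ψ ρ aΨ :=
  ⟨preservesThetaSaturated_of Ψ Ψbs eΨ aΨ, preservesRigidityIso_of_unique Ψ Ψbs eΨ aΨ ρ hB huniq hρ hlin haΨ hpull hBN⟩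

/-- **Thm. 5.6, second clause, from print's ROOFS** «`S″ → S`, `S″ → B_N`» (Prop. 5.5 proof p.328 l.2–11): `huniq` DISCHARGED by
this seat's `rigidityFamily_unique_of_roof` — every theta-saturated `S` admits a theta-saturated `S″` with linear `S″ → B_N`, `S″ → S`,
the latter onto on `(l·Δ_Θ) ⊗ ℤ/Nℤ` and injective on `μ_N`.  [cite: MochizukiEtTh2009, Thm 5.6 proof p.329 (PDF p.103)] -/
theorem preservesRigidityIso_of_roofs
    (aΨ : ∀ S : C, 𝔉.lDeltaModN S ≃* 𝔉.lDeltaModN (Ψ.functor.obj S))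
    (ρ : RigidityFamily 𝔉) (hB : 𝔉.IsThetaSaturated 𝔉.BN)
    (hroof : ∀ S : C, 𝔉.IsThetaSaturated S → ∃ (S'' : C) (_ : 𝔉.IsThetaSaturated S'') (φ : S'' ⟶ 𝔉.BN) (ψ : S'' ⟶ S),
      𝔉.IsLinear φ ∧ 𝔉.IsLinear ψ ∧ Function.Surjective (𝔉.lDeltaModNMap ψ) ∧ Function.Injective (𝔉.muTorsionPull ψ 𝔉.N))
    (hρ : IsFunctorialLinear 𝔉 ρ)
    (hlin : PreFrobenioidData.PreservesMor Ψ.functor 𝔉.IsLinear 𝔉.IsLinear)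
    (haΨ : ∀ {S T : C} (φ : S ⟶ T) (x : 𝔉.lDeltaModN S),
      aΨ T (𝔉.lDeltaModNMap φ x) = 𝔉.lDeltaModNMap (Ψ.functor.map φ) (aΨ S x))
    (hpull : ∀ {S T : C} (φ : S ⟶ T), 𝔉.IsLinear φ → ∀ (u : 𝔉.muTorsion T 𝔉.N)
      (hu : Ψ.functor.mapAut T (u : Aut T) ∈ 𝔉.muTorsion (Ψ.functor.obj T) 𝔉.N),
      Ψ.functor.mapAut S (𝔉.muTorsionPull φ 𝔉.N u : Aut S) =
        (𝔉.muTorsionPull (Ψ.functor.map φ) 𝔉.N ⟨_, hu⟩ : Aut (Ψ.functor.obj S)))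
    (hBN : ∀ (hΨB : 𝔉.IsThetaSaturated (Ψ.functor.obj 𝔉.BN)) (x : 𝔉.lDeltaModN 𝔉.BN),
      (Ψ.functor.mapAut 𝔉.BN (ρ 𝔉.BN hB x : Aut 𝔉.BN) : Aut (Ψ.functor.obj 𝔉.BN)) =
        ρ (Ψ.functor.obj 𝔉.BN) hΨB (aΨ 𝔉.BN x)) :
    PreservesRigidityIso 𝔉 Ψ ρ aΨ :=
  preservesRigidityIso_of_unique Ψ Ψbs eΨ aΨ ρ hB
    (fun _ hρ' hBN' => rigidityFamily_unique_of_roof 𝔉 hroof hB hρ' hρ hBN') hρ hlin haΨ hpull hBN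

/-- **[EtTh] Theorem 5.6 (both clauses) modulo its cited inputs, ROOF FORM** — abc-iut-L2-d4's `cyclotomicRigidityPreserved_of` with the
depth-constrained `hreach : LinearlyReachableFromBN` REPLACED by print's roofs `hroof` and `hpull` linear-only; other binders
(`Ψbs`, `eΨ`, `aΨ` + `haΨ`, `hρ`, `hlin`, `hBN`) exactly d4's.  [cite: MochizukiEtTh2009, Thm 5.6 p.328–329 (PDF pp.102–103)] -/
theorem cyclotomicRigidityPreserved_of_roofs
    (aΨ : ∀ S : C, 𝔉.lDeltaModN S ≃* 𝔉.lDeltaModN (Ψ.functor.obj S))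
    (ρ : RigidityFamily 𝔉) (hB : 𝔉.IsThetaSaturated 𝔉.BN)
    (hroof : ∀ S : C, 𝔉.IsThetaSaturated S → ∃ (S'' : C) (_ : 𝔉.IsThetaSaturated S'') (φ : S'' ⟶ 𝔉.BN) (ψ : S'' ⟶ S),
      𝔉.IsLinear φ ∧ 𝔉.IsLinear ψ ∧ Function.Surjective (𝔉.lDeltaModNMap ψ) ∧ Function.Injective (𝔉.muTorsionPull ψ 𝔉.N))
    (hρ : IsFunctorialLinear 𝔉 ρ)
    (hlin : PreFrobenioidData.PreservesMor Ψ.functor 𝔉.IsLinear 𝔉.IsLinear)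
    (haΨ : ∀ {S T : C} (φ : S ⟶ T) (x : 𝔉.lDeltaModN S),
      aΨ T (𝔉.lDeltaModNMap φ x) = 𝔉.lDeltaModNMap (Ψ.functor.map φ) (aΨ S x))
    (hpull : ∀ {S T : C} (φ : S ⟶ T), 𝔉.IsLinear φ → ∀ (u : 𝔉.muTorsion T 𝔉.N)
      (hu : Ψ.functor.mapAut T (u : Aut T) ∈ 𝔉.muTorsion (Ψ.functor.obj T) 𝔉.N),
      Ψ.functor.mapAut S (𝔉.muTorsionPull φ 𝔉.N u : Aut S) =
        (𝔉.muTorsionPull (Ψ.functor.map φ) 𝔉.N ⟨_, hu⟩ : Aut (Ψ.functor.obj S)))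
    (hBN : ∀ (hΨB : 𝔉.IsThetaSaturated (Ψ.functor.obj 𝔉.BN)) (x : 𝔉.lDeltaModN 𝔉.BN),
      (Ψ.functor.mapAut 𝔉.BN (ρ 𝔉.BN hB x : Aut 𝔉.BN) : Aut (Ψ.functor.obj 𝔉.BN)) =
        ρ (Ψ.functor.obj 𝔉.BN) hΨB (aΨ 𝔉.BN x)) :
    CyclotomicRigidityPreserved 𝔉 Ψ ρ aΨ :=
  ⟨preservesThetaSaturated_of Ψ Ψbs eΨ aΨ, preservesRigidityIso_of_roofs Ψ Ψbs eΨ aΨ ρ hB hroof hρ hlin haΨ hpull hBN⟩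

/-- Back-compatibility: abc-iut-L2-d4's own binder list (fixed source `hreach : LinearlyReachableFromBN`, via abc-iut-L2-t4's
`rigidityFamily_unique_of`) with `hpull` weakened to linear `φ`.  [cite: MochizukiEtTh2009, Thm 5.6 p.328–329 (PDF pp.102–103)] -/
theorem cyclotomicRigidityPreserved_of_reach
    (aΨ : ∀ S : C, 𝔉.lDeltaModN S ≃* 𝔉.lDeltaModN (Ψ.functor.obj S))
    (ρ : RigidityFamily 𝔉) (hB : 𝔉.IsThetaSaturated 𝔉.BN) (hreach : LinearlyReachableFromBN 𝔉)
    (hρ : IsFunctorialLinear 𝔉 ρ)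
    (hlin : PreFrobenioidData.PreservesMor Ψ.functor 𝔉.IsLinear 𝔉.IsLinear)
    (haΨ : ∀ {S T : C} (φ : S ⟶ T) (x : 𝔉.lDeltaModN S),
      aΨ T (𝔉.lDeltaModNMap φ x) = 𝔉.lDeltaModNMap (Ψ.functor.map φ) (aΨ S x))
    (hpull : ∀ {S T : C} (φ : S ⟶ T), 𝔉.IsLinear φ → ∀ (u : 𝔉.muTorsion T 𝔉.N)
      (hu : Ψ.functor.mapAut T (u : Aut T) ∈ 𝔉.muTorsion (Ψ.functor.obj T) 𝔉.N),
      Ψ.functor.mapAut S (𝔉.muTorsionPull φ 𝔉.N u : Aut S) =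
        (𝔉.muTorsionPull (Ψ.functor.map φ) 𝔉.N ⟨_, hu⟩ : Aut (Ψ.functor.obj S)))
    (hBN : ∀ (hΨB : 𝔉.IsThetaSaturated (Ψ.functor.obj 𝔉.BN)) (x : 𝔉.lDeltaModN 𝔉.BN),
      (Ψ.functor.mapAut 𝔉.BN (ρ 𝔉.BN hB x : Aut 𝔉.BN) : Aut (Ψ.functor.obj 𝔉.BN)) =
        ρ (Ψ.functor.obj 𝔉.BN) hΨB (aΨ 𝔉.BN x)) :
    CyclotomicRigidityPreserved 𝔉 Ψ ρ aΨ :=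
  cyclotomicRigidityPreserved_of_unique Ψ Ψbs eΨ aΨ ρ hB
    (fun _ hρ' hBN' => rigidityFamily_unique_of 𝔉 hreach hB hρ' hρ hBN') hρ hlin haΨ hpull hBN

end Transport

/-! ### T56-A in roof form: abc-iut-w5-d020's assembly with `hBN` derived (T56-L09) and `hreach ↦ hroof` -/

namespace Thm56Sub

variable (α : Ψ.functor.obj 𝔉.AN ≅ 𝔉.AN) (β : Ψ.functor.obj 𝔉.BN ≅ 𝔉.BN) (e : 𝔉.AN ≅ 𝔉.AN)
  (Dp : Aut 𝔉.BN) (θ : Aut (𝔉.base.obj 𝔉.BN) ≃* Aut (𝔉.base.obj 𝔉.BN))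

/-- **EtTh:Thm5.6(i)/T56-A in ROOF form** — abc-iut-w5-d020's `cyclotomicRigidityPreserved_of_sub` ([EtTh] Thm. 5.6, both clauses, with
the transport at `B_N` DERIVED by `transportAtBN_of`, T56-L09) with the fixed-source `hreach : LinearlyReachableFromBN` REPLACED by
print's roofs `hroof` (T56-L10 via `rigidityFamily_unique_of_roof`) and `hpull` linear-only; every other binder verbatim hers
(`Ψbs`, `eΨ`, `aΨ` + `haΨ`, `hρ`, `hlin`, `hcap`, `hcup`, `hdiff`, `hT`, `hT'`, `hu`, `hstrv`, `hYdd`, `P`, `hcentral`, `hspec`,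
`hcompat`, `hK`, `hcov`).  [cite: MochizukiEtTh2009, Thm 5.6 p.328–329 (PDF pp.102–103)] -/
theorem cyclotomicRigidityPreserved_of_sub_roofs [Epi 𝔉.sCap] [Epi 𝔉.sCup]
    (Ψbs : D ⥤ D) [Ψbs.Faithful] (eΨ : Ψ.functor ⋙ 𝔉.base ≅ 𝔉.base ⋙ Ψbs)
    (aΨ : ∀ S : C, 𝔉.lDeltaModN S ≃* 𝔉.lDeltaModN (Ψ.functor.obj S))
    (ρ : RigidityFamily 𝔉) (hB : 𝔉.IsThetaSaturated 𝔉.BN)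
    (hroof : ∀ S : C, 𝔉.IsThetaSaturated S → ∃ (S'' : C) (_ : 𝔉.IsThetaSaturated S'') (φ : S'' ⟶ 𝔉.BN) (ψ : S'' ⟶ S),
      𝔉.IsLinear φ ∧ 𝔉.IsLinear ψ ∧ Function.Surjective (𝔉.lDeltaModNMap ψ) ∧ Function.Injective (𝔉.muTorsionPull ψ 𝔉.N))
    (hρ : IsFunctorialLinear 𝔉 ρ)
    (hlin : PreFrobenioidData.PreservesMor Ψ.functor 𝔉.IsLinear 𝔉.IsLinear)
    (haΨ : ∀ {S T : C} (φ : S ⟶ T) (x : 𝔉.lDeltaModN S),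
      aΨ T (𝔉.lDeltaModNMap φ x) = 𝔉.lDeltaModNMap (Ψ.functor.map φ) (aΨ S x))
    (hpull : ∀ {S T : C} (φ : S ⟶ T), 𝔉.IsLinear φ → ∀ (u : 𝔉.muTorsion T 𝔉.N)
      (hu : Ψ.functor.mapAut T (u : Aut T) ∈ 𝔉.muTorsion (Ψ.functor.obj T) 𝔉.N),
      Ψ.functor.mapAut S (𝔉.muTorsionPull φ 𝔉.N u : Aut S) =
        (𝔉.muTorsionPull (Ψ.functor.map φ) 𝔉.N ⟨_, hu⟩ : Aut (Ψ.functor.obj S)))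
    (hcap : 𝔉.SgpCapSpec) (hcup : 𝔉.SgpCupSpec) (hdiff : 𝔉.BiKummerDifferenceMem)
    (hT : α.inv ≫ Ψ.functor.map 𝔉.sCap ≫ β.hom = e.hom ≫ 𝔉.sCap ≫ (1 : Aut 𝔉.BN).hom)
    (hT' : α.inv ≫ Ψ.functor.map 𝔉.sCup ≫ β.hom = e.hom ≫ 𝔉.sCup ≫ Dp.hom) (hu : Dp ∈ 𝔉.units 𝔉.BN)
    (hstrv : 𝔉.StrvTransport Ψ α e θ) (hYdd : 𝔉.HB.map θ.toMonoidHom = 𝔉.HB)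
    (P : ThetaSubquotientProj 𝔉) (hcentral : UnitsCentralUnderLDelta 𝔉 P) (hspec : UnitsPullSpec 𝔉)
    (hcompat : DeltaTransportCompat 𝔉 Ψ β aΨ θ P) (hK : IsKummerDetermined 𝔉 P ρ hB)
    (hcov : LDeltaCovered 𝔉 P) :
    CyclotomicRigidityPreserved 𝔉 Ψ ρ aΨ :=
  cyclotomicRigidityPreserved_of_roofs Ψ Ψbs eΨ aΨ ρ hB hroof hρ hlin haΨ hpull
    (fun hΨB x => transportAtBN_of Ψ α β e Dp θ hcap hcup hdiff hT hT' hu hstrv hYdd P hcentral hspec aΨ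
      hcompat ρ hB hK hρ hcov hΨB x)

end Thm56Sub

end ThetaFrobenioid

end Literature.AnabelianGeometry.EtaleTheta
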